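import Literature.Geometry.Symplectic.TaubesCanonicalClassSymplecticCurveFourProofs
import Literature.Geometry.Symplectic.HirzebruchSignatureAlmostComplexFour
import Literature.Geometry.Symplectic.TaubesCanonicalClassCurveUpToSign
import HarnessLib

/-!
# `taubes_canonicalClass_symplecticCurve_four` from its three printed inputs (assembly)

Topic `Literature/Geometry/Symplectic`.  Theorems only.

The named fact `Literature.Geometry.Symplectic.taubes_canonicalClass_symplecticCurve_four`
(`TaubesCanonicalClassSymplecticCurveFour.lean`: Taubes, MRL 2 (1995) 221, Thm. A (1), bundled with
the `b⁺ = 1` companion of Li–Liu and the identities `b⁺ ≥ 1`, `K² = 2χ + 3σ`) is PROVED on the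
tree's named objects modulo exactly three separately printed theorems
(`taubes_canonicalClass_symplecticCurve_four_of_hirzebruchPrinted_of_taubes_upToSign`,
`TaubesCanonicalClassSymplecticCurveFourProofs.lean`, which proves everything else: the symplectic
orientation from de Rham's theorem, `b⁺ ≥ 1`, the `ω`-area functional, the packaging).  Those three
inputs are now named facts of the tree, each character for character the corresponding hypothesis
of that theorem:

* `hirzebruch_firstChernClass_sq_eq_almostComplex_four` (`HirzebruchSignatureAlmostComplexFour.lean`)
  — Hirzebruch, `⟨c₁ ⌣ c₁, [N]_μ⟩ = 2χ + 3σ(μ)` for a closed almost complex `4`-manifold with the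
  orientation induced by `J` [McDuff–Salamon 2017, Rem. 4.1.10 eq. (4.1.7)];
* `taubes1995_hasTaubesCurve_canonicalClass_of_two_le_bPlus` (`TaubesCanonicalClassCurveUpToSign.lean`)
  — Taubes 1995, Thm. A (1) with §3 (3.2) and Prop. 4.2 (`b⁺ ≥ 2`), sign-free form;
* `liLiu1995_hasTaubesCurve_canonicalClass_of_bPlus_eq_one` (same file) — the `b⁺ = 1` case,
  Li–Liu, sign-free form.

This file is the one-line assembly `taubes_canonicalClass_symplecticCurve_four_of_split`: the named
fact follows from the three named facts; once they are discharged,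
`taubes_canonicalClass_symplecticCurve_four_holds` is
`taubes_canonicalClass_symplecticCurve_four_of_split X₁_holds X₂_holds X₃_holds`.

## References

* C. H. Taubes, *The Seiberg–Witten and Gromov invariants*, Math. Res. Lett. 2 (1995) 221–238,
  Thm. A (1) p. 221, §3 eq. (3.2) p. 228, Thm. 4.1 and Prop. 4.2 p. 231. [Taubes1995]
* C. H. Taubes, *The Seiberg–Witten invariants and symplectic forms*, Math. Res. Lett. 1 (1994)
  809–822, Main Theorem (p. 809). [Taubes1994]
* T. J. Li, A. Liu, *General wall crossing formula*, Math. Res. Lett. 2 (1995) 797–810, Thm. 1.2,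
  Cor. 1.3 and the remark after Cor. 1.6 (p. 799). [LiLiu1995]
* T. J. Li, A. Liu, *Symplectic structure on ruled surfaces and a generalized adjunction formula*,
  Math. Res. Lett. 2 (1995) 453–471, §0 (p. 454). [LiLiu1995Ruled]
* T. J. Li, A. K. Liu, *The equivalence between SW and Gr in the case where b⁺ = 1*, Int. Math.
  Res. Not. 1999, no. 7, 335–345, Main Theorem. [LiLiu1999]
* D. McDuff, D. Salamon, *Introduction to Symplectic Topology*, 3rd ed. (2017), Rem. 4.1.10
  eq. (4.1.7); §13.3: Thm. 13.3.10, Thm. 13.3.21, Thm. 13.3.22, Cor. 13.3.23, Cor. 13.3.24 (ii).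
  [McDuffSalamon2017]
-/

noncomputable section

namespace Literature.Geometry.Symplectic

/-- **The named fact from its three printed inputs.**  Taubes's theorem
`taubes_canonicalClass_symplecticCurve_four` follows from Hirzebruch's `c₁² = 2χ + 3σ`
(`hirzebruch_firstChernClass_sq_eq_almostComplex_four`), Taubes 1995 Thm. A (1) for `b⁺ ≥ 2`
(`taubes1995_hasTaubesCurve_canonicalClass_of_two_le_bPlus`) and its `b⁺ = 1` companion
(`liLiu1995_hasTaubesCurve_canonicalClass_of_bPlus_eq_one`) — one line, the tree's
`taubes_canonicalClass_symplecticCurve_four_of_hirzebruchPrinted_of_taubes_upToSign`, whose three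
hypotheses these facts are verbatim.
[cite: Taubes1995, Thm. A (1), §3 (3.2), Prop. 4.2]
[cite: McDuffSalamon2017, Rem. 4.1.10 eq. (4.1.7); Cor. 13.3.23; Cor. 13.3.24 (ii)] -/
theorem taubes_canonicalClass_symplecticCurve_four_of_split
    (hB : hirzebruch_firstChernClass_sq_eq_almostComplex_four)
    (hC₂ : taubes1995_hasTaubesCurve_canonicalClass_of_two_le_bPlus)
    (hC₁ : liLiu1995_hasTaubesCurve_canonicalClass_of_bPlus_eq_one) :
    taubes_canonicalClass_symplecticCurve_four :=
  taubes_canonicalClass_symplecticCurve_four_of_hirzebruchPrinted_of_taubes_upToSign hB hC₂ hC₁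

end Literature.Geometry.Symplectic

end
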